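import Literature.AlgebraicGeometry.ShimuraVarieties.UnitaryBallProjectiveSystems
import HarnessLib

/-!
# Compact ball quotients are projective: Shafarevich's theorem, assembled from point and tangent separation

Let `Δ ≤ U(2,1)` act freely (`IsCancelSMul Δ Ball`) and properly discontinuously on the ball `𝔹²`,
with `Δ` cocompact in `U(2,1)` (`CompactSpace (U21 ⧸ Δ)`), so that `X = Δ\𝔹²`
(`MulAction.orbitRel.Quotient Δ Ball`) is a compact complex manifold of dimension `2`
(`Literature/Geometry/ComplexHyperbolic/UnitBallQuotientManifold.lean`). **Theorem** (Shafarevich,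
*Basic Algebraic Geometry 2*, Ch. IX §3.2, cocompact case; Poincaré, Siegel; Kodaira for the general
principle): *if the holomorphic automorphic forms of the canonical cocycle `J(δ, z)ᵏ` separate points and
tangent vectors of `𝔹²` modulo `Δ`, then a finite system `f₀, …, f_N` of such forms of one weight defines
a holomorphic injective immersion `X → ℙᴺ(ℂ)`, `Δ·z ↦ [f₀(z) : ⋯ : f_N(z)]`.*

* `exists_projective_embedding_of_separation` — **the theorem**, with the two pointwise hypotheses
  `hsep` (two points in different orbits are separated by a `2 × 2` minor of two forms of a positive
  weight) and `himm` (at each point a finite system of a positive weight is non-vanishing with injective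
  projectivised differential, kernel form), and the conclusion
  `∃ N (F : orbitRel.Quotient Δ Ball → ℙ ℂ (Fin (N + 1) → ℂ)), ContMDiff 𝓘(ℂ, ℂ²) 𝓘(ℂ, ℂᴺ) ω F ∧
   Injective F ∧ ∀ x, Injective (mfderiv _ _ F x)`;
* `exists_projective_embedding_of_det` — the same with tangent separation in DETERMINANT form (three
  forms whose `3 × 3` matrix of values and first derivatives at the point is invertible, the shape of
  `BallPoincare.exists_poincareSeries_immersion_subgroup` of `UnitaryBallPoincareImmersion.lean`;
  `imm_of_det_ne_zero`), and `exists_projective_embedding_of_hasFDerivAt` — with `HasFDerivAt` witnesses for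
  the first derivatives, its literal shape; `exists_projective_embedding_of_separation_of_cocompact` — the
  variant for `Δ` cocompact in `U(2,1)` (`CompactSpace (U21 ⧸ Δ)`);
* `exists_common_weight` — finitely many systems of positive weights are raised into one system of the
  product weight.

The proof (§9): by compactness of `X` finitely many immersion systems suffice; raised to one weight
`K₁` they give a system `T₁` immersive everywhere (`isOpen_setOf_imm`, `imm_raise`); an immersive
point has a neighbourhood on which `[T₁]` is injective (`exists_isOpen_eq_of_proportional`), whence an
open neighbourhood `N` of the diagonal of `X × X` on which distinct points are separated
by `T₁`; the compact complement of `N` is covered by finitely many separation systems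
(`isOpen_setOf_sep`); everything is raised to one common weight `K` (`exists_common_weight`), and the
resulting system `T` is non-vanishing, separating and immersive everywhere; `F` is the descent of
`z ↦ [f(z)]_{f ∈ T}` (`contMDiff_of_comp_mk`, `injective_mfderiv_of_comp_mk`,
`injective_mfderiv_projectivizationMk`). The pointwise hypotheses are the statements of rows D4 (c1)
(point separation by Poincaré series) and D4 (c2) (tangent separation,
`UnitaryBallPoincareImmersion.lean`) of the cell's plan; with them this theorem yields, for every such
`Δ`, the conclusion of the record `compactBallQuotient_projectiveEmbedding`
(`CompactBallQuotientProjectiveEmbedding.lean`).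

References: I. R. Shafarevich, *Basic Algebraic Geometry 2* (Springer 1994), Ch. IX §3.2, Theorem
and its two Lemmas (held: `book:shafarevich1994-basic-algebraic-geometry-2-schemes-amd-complex`,
chunks p0269–p0271); P. Griffiths, J. Harris, *Principles of Algebraic Geometry* (1978), Ch. 1 §4
(Kodaira's embedding: injective + immersive from separation of points and tangents);
N. Bergeron, J. Millson, C. Moeglin, Acta Math. 216 (2016), §1.1.

## Provenance

pub-hodgecm2 cell (COR-CM, Hodge ladder stage 2), LIT-FANOUT row D4 (c3), claim `D4-6-asm`
(seat b06, 2026-08-20/21). Theorems only; no definitions, no named facts.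
-/

set_option autoImplicit false

noncomputable section

open scoped Manifold ContDiff Topology LinearAlgebra.Projectivization
open Set Filter MulAction
open Literature.Geometry.ComplexHyperbolic
open Literature.Geometry.ComplexHyperbolic.BallModel (U21 Ball nsq)
open Literature.NumberTheory.Automorphic.AutomorphyFactor

namespace Literature.AlgebraicGeometry.ShimuraVarieties

namespace BallProjective

open BallForms (holFactorForms canonicalCocycle canonicalFactor extend holomorphic ballSet
  canonicalFactor_ne_zero isOpen_ballSet)

variable {Δ : Subgroup U21}

/-! ### §9 The projective embedding of a compact ball quotient -/

section Embedding

open scoped Classical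

/-- **One common weight.** Finitely many systems `S i` of positive weights `k i` can be raised to the
common weight `K = ∏ k i`: there is one system `T` of weight `K` containing a raising of each `S i`.
[cite: Shafarevich1994, Ch. IX §3.2 (proof of the Theorem)] -/
theorem exists_common_weight {ι : Type*} (I : Finset ι) (k : ι → ℕ) (S : ι → Finset (Ball → ℂ))
    (hk : ∀ i ∈ I, 0 < k i)
    (hS : ∀ i ∈ I, ∀ f ∈ S i, f ∈ holFactorForms Δ (canonicalCocycle ℂ (k i))) :
    ∃ K, 0 < K ∧ ∃ T : Finset (Ball → ℂ), (∀ F ∈ T, F ∈ holFactorForms Δ (canonicalCocycle ℂ K)) ∧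
      ∀ i ∈ I, ∃ j, (S i ×ˢ S i).image (fun p ↦ p.1 * p.2 ^ j) ⊆ T := by
  refine ⟨∏ i ∈ I, k i, Finset.prod_pos hk,
    I.biUnion fun i ↦ (S i ×ˢ S i).image (fun p ↦ p.1 * p.2 ^ ((∏ i ∈ I, k i) / k i - 1)),
    fun F hF ↦ ?_, fun i hi ↦ ⟨(∏ i ∈ I, k i) / k i - 1, Finset.subset_biUnion_of_mem
      (fun i ↦ (S i ×ˢ S i).image (fun p ↦ p.1 * p.2 ^ ((∏ i ∈ I, k i) / k i - 1))) hi⟩⟩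
  obtain ⟨i, hi, hFi⟩ := Finset.mem_biUnion.1 hF
  have hdvd : k i ∣ ∏ i ∈ I, k i := Finset.dvd_prod_of_mem k hi
  have hpos : 0 < (∏ i ∈ I, k i) / k i :=
    Nat.div_pos (Nat.le_of_dvd (Finset.prod_pos hk) hdvd) (hk i hi)
  have hK : k i * ((∏ i ∈ I, k i) / k i - 1 + 1) = ∏ i ∈ I, k i := by
    rw [Nat.sub_add_cancel hpos, Nat.mul_div_cancel' hdvd]
  rw [← hK]
  exact mem_of_mem_raise (hS i hi) _ F hFi

variable (Δ) [ProperlyDiscontinuousSMul Δ Ball] [IsCancelSMul Δ Ball]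

/-- Transport of the immersion condition to the raised system inside a bigger system of the new weight.
[cite: Shafarevich1994, Ch. IX §3.2, proof of the Theorem] -/
theorem imm_mono_raise {S T : Finset (Ball → ℂ)} (hS : ∀ f ∈ S, f ∈ holomorphic ℂ) {j : ℕ}
    (hST : (S ×ˢ S).image (fun p ↦ p.1 * p.2 ^ j) ⊆ T) {z : Ball}
    (h : (∃ f ∈ S, f z ≠ 0) ∧ ∀ (u : Fin 2 → ℂ) (μ : ℂ),
      (∀ f ∈ S, fderiv ℂ (extend ℂ f) z.1 u = μ * f z) → u = 0) :
    (∃ f ∈ T, f z ≠ 0) ∧ ∀ (u : Fin 2 → ℂ) (μ : ℂ),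
      (∀ f ∈ T, fderiv ℂ (extend ℂ f) z.1 u = μ * f z) → u = 0 := by
  obtain ⟨F, hF, hFz⟩ := exists_ne_zero_raise j h.1
  exact ⟨⟨F, hST hF, hFz⟩, fun u μ hu ↦ imm_raise hS j h.1 h.2 u μ fun F hF ↦ hu F (hST hF)⟩

omit [ProperlyDiscontinuousSMul Δ Ball] [IsCancelSMul Δ Ball] in
/-- Transport of the separation condition to the raised system inside a bigger system. [cite: Shafarevich1994, Ch. IX §3.2, proof of the Theorem] -/
theorem sep_mono_raise {S T : Finset (Ball → ℂ)} {j : ℕ}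
    (hST : (S ×ˢ S).image (fun p ↦ p.1 * p.2 ^ j) ⊆ T) {z w : Ball}
    (h : ∃ f ∈ S, ∃ g ∈ S, f z * g w ≠ f w * g z) :
    ∃ f ∈ T, ∃ g ∈ T, f z * g w ≠ f w * g z := by
  obtain ⟨F, hF, G, hG, hne⟩ := exists_sep_raise j h
  exact ⟨F, hST hF, G, hST hG, hne⟩

/-- **Shafarevich's theorem on the ball — assembly** (*Basic Algebraic Geometry 2*, Ch. IX §3.2,
Theorem, compact case; written there for polydiscs, with the Remark that the proof carries over to
bounded domains in `ℂⁿ` with `J_g` the Jacobian). Let `Δ ≤ U(2,1)` act freely and properly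
discontinuously on `𝔹²` with compact quotient `X = Δ\𝔹²`. Suppose that the holomorphic automorphic forms
of the canonical cocycle `J(δ, z)ᵏ` (`holFactorForms Δ (canonicalCocycle ℂ k)`) **separate points**
(`hsep`: two points in different orbits are separated by a `2 × 2` minor of two forms of one positive
weight) and **separate tangent vectors** (`himm`: at every point some finite system of one positive weight
does not vanish and has injective projectivised differential, in kernel form). Then there are `N` and a
map `F : X → ℙᴺ(ℂ)` which is holomorphic, injective and an immersion — `F(Δ·z) = [f₀(z) : ⋯ : f_N(z)]`
for a suitable finite system of forms of one weight, obtained from the local data by compactness of `X`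
and of the complement of a neighbourhood of the diagonal in `X × X`, and by raising to a common weight.
[cite: Shafarevich1994, Ch. IX §3.2, Theorem] -/
theorem exists_projective_embedding_of_separation [CompactSpace (orbitRel.Quotient Δ Ball)]
    (hsep : ∀ z w : Ball, (∀ δ : Δ, δ • z ≠ w) → ∃ k, 0 < k ∧
      ∃ f ∈ holFactorForms Δ (canonicalCocycle ℂ k), ∃ g ∈ holFactorForms Δ (canonicalCocycle ℂ k),
        f z * g w ≠ f w * g z)
    (himm : ∀ z : Ball, ∃ k, 0 < k ∧ ∃ S : Finset (Ball → ℂ),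
      (∀ f ∈ S, f ∈ holFactorForms Δ (canonicalCocycle ℂ k)) ∧ (∃ f ∈ S, f z ≠ 0) ∧
        ∀ (u : Fin 2 → ℂ) (μ : ℂ), (∀ f ∈ S, fderiv ℂ (extend ℂ f) z.1 u = μ * f z) → u = 0) :
    ∃ (N : ℕ) (F : orbitRel.Quotient Δ Ball → ℙ ℂ (Fin (N + 1) → ℂ)),
      ContMDiff 𝓘(ℂ, Fin 2 → ℂ) 𝓘(ℂ, Fin N → ℂ) ω F ∧ Function.Injective F ∧
        ∀ x, Function.Injective (mfderiv 𝓘(ℂ, Fin 2 → ℂ) 𝓘(ℂ, Fin N → ℂ) F x) := by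
  -- the projection and its basic properties
  set mk : Ball → orbitRel.Quotient Δ Ball :=
    Literature.Geometry.Manifold.QuotientManifold.mk (G := Δ) (M := Ball) with hmk_def
  have hmk_open : IsOpenMap mk := (BallModel.isLocalDiffeomorph_mk Δ).isOpenMap
  have hmk_eq : ∀ z w : Ball, mk z = mk w ↔ ∃ δ : Δ, δ • w = z := fun z w ↦
    Literature.Geometry.Manifold.QuotientManifold.mk_eq_mk_iff
  have hmk_out : ∀ q : orbitRel.Quotient Δ Ball, mk q.out = q := fun q ↦ Quotient.out_eq q
  /- Step 1: immersion systems, a finite subcover of `X`, one weight `K₁`, system `T₁` -/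
  choose kI hkI SI hSI hnzI himmI using himm
  have hO : ∀ z : Ball, IsOpen (mk '' {w : Ball | (∃ f ∈ SI z, f w ≠ 0) ∧ ∀ (u : Fin 2 → ℂ) (μ : ℂ),
      (∀ f ∈ SI z, fderiv ℂ (extend ℂ f) w.1 u = μ * f w) → u = 0}) := fun z ↦
    hmk_open _ (isOpen_setOf_imm fun f hf ↦ (BallForms.mem_holFactorForms_iff.1 (hSI z f hf)).2)
  obtain ⟨t₁, ht₁⟩ := isCompact_univ.elim_finite_subcover
    (fun q : orbitRel.Quotient Δ Ball ↦ mk '' {w : Ball | (∃ f ∈ SI q.out, f w ≠ 0) ∧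
      ∀ (u : Fin 2 → ℂ) (μ : ℂ), (∀ f ∈ SI q.out, fderiv ℂ (extend ℂ f) w.1 u = μ * f w) → u = 0})
    (fun q ↦ hO q.out)
    (fun q _ ↦ Set.mem_iUnion.2 ⟨q, ⟨q.out, ⟨hnzI q.out, himmI q.out⟩, hmk_out q⟩⟩)
  obtain ⟨K₁, hK₁, T₁, hT₁, hraise₁⟩ := exists_common_weight (Δ := Δ) t₁ (fun q ↦ kI q.out)
    (fun q ↦ SI q.out) (fun q _ ↦ hkI q.out) (fun q _ ↦ hSI q.out)
  have hT₁hol : ∀ f ∈ T₁, f ∈ holomorphic ℂ := fun f hf ↦ (BallForms.mem_holFactorForms_iff.1 (hT₁ f hf)).2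
  -- every point of `X` has a representative at which `T₁` is immersive
  have himm₁ : ∀ q : orbitRel.Quotient Δ Ball, ∃ w : Ball, mk w = q ∧ (∃ f ∈ T₁, f w ≠ 0) ∧
      ∀ (u : Fin 2 → ℂ) (μ : ℂ), (∀ f ∈ T₁, fderiv ℂ (extend ℂ f) w.1 u = μ * f w) → u = 0 := by
    intro q
    obtain ⟨p, hp, hq⟩ := Set.mem_iUnion₂.1 (ht₁ (Set.mem_univ q))
    obtain ⟨w, hw, rfl⟩ := hq
    obtain ⟨j, hj⟩ := hraise₁ p hp
    exact ⟨w, rfl, imm_mono_raise (fun f hf ↦ (BallForms.mem_holFactorForms_iff.1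
      (hSI p.out f hf)).2) hj hw⟩
  -- non-vanishing of `T₁` at every point (it only depends on the orbit)
  have hnz₁ : ∀ z : Ball, ∃ f ∈ T₁, f z ≠ 0 := by
    intro z
    obtain ⟨w, hw, hnz, -⟩ := himm₁ (mk z)
    obtain ⟨δ, rfl⟩ := (hmk_eq w z).1 hw
    exact (exists_ne_zero_smul_iff hT₁ δ z).1 hnz
  /- Step 2: a neighbourhood of the diagonal of `X × X` on which `T₁` separates points -/
  have hV : ∀ q : orbitRel.Quotient Δ Ball, ∃ V : Set Ball, IsOpen V ∧ (∃ w ∈ V, mk w = q) ∧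
      ∀ w₁ ∈ V, ∀ w₂ ∈ V, w₁ ≠ w₂ → ∃ f ∈ T₁, ∃ g ∈ T₁, f w₁ * g w₂ ≠ f w₂ * g w₁ := by
    intro q
    obtain ⟨w, hwq, ⟨f₀, hf₀, hf₀w⟩, himmw⟩ := himm₁ q
    obtain ⟨V, hVo, hwV, hVinj⟩ := exists_isOpen_eq_of_proportional (ι := T₁) (g := fun f ↦ f.1)
      (fun f ↦ hT₁hol f.1 f.2) (z := w) (i₀ := ⟨f₀, hf₀⟩) hf₀w
      (fun u μ hu ↦ himmw u μ fun f hf ↦ hu ⟨f, hf⟩)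
    refine ⟨V, hVo, ⟨w, hwV, hwq⟩, fun w₁ hw₁ w₂ hw₂ hne ↦ ?_⟩
    by_contra hall
    push Not at hall
    obtain ⟨f₁, hf₁, hf₁w⟩ := hnz₁ w₁
    obtain ⟨c, hc⟩ := exists_eq_mul_of_minors_eq_zero (ι := T₁) (a := fun f ↦ f.1 w₁)
      (b := fun f ↦ f.1 w₂) (i₀ := ⟨f₁, hf₁⟩) hf₁w (fun f g ↦ by rw [hall f.1 f.2 g.1 g.2]; ring)
    exact hne (hVinj w₁ hw₁ w₂ hw₂ ⟨c, fun f ↦ hc f⟩)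
  choose V hVo hVq hVsep using hV
  set Nd : Set (orbitRel.Quotient Δ Ball × orbitRel.Quotient Δ Ball) :=
    ⋃ q, (mk '' V q) ×ˢ (mk '' V q) with hNd
  have hNdo : IsOpen Nd := isOpen_iUnion fun q ↦ (hmk_open _ (hVo q)).prod (hmk_open _ (hVo q))
  have hdiag : ∀ q, (q, q) ∈ Nd := by
    intro q
    obtain ⟨w, hwV, hwq⟩ := hVq q
    exact Set.mem_iUnion.2 ⟨q, ⟨w, hwV, hwq⟩, ⟨w, hwV, hwq⟩⟩
  have hNdsep : ∀ P ∈ Nd, P.1 ≠ P.2 → ∃ z w : Ball, mk z = P.1 ∧ mk w = P.2 ∧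
      ∃ f ∈ T₁, ∃ g ∈ T₁, f z * g w ≠ f w * g z := by
    rintro P hP hne
    obtain ⟨q, ⟨z, hzV, hz⟩, ⟨w, hwV, hw⟩⟩ := Set.mem_iUnion.1 hP
    refine ⟨z, w, hz, hw, hVsep q z hzV w hwV ?_⟩
    rintro rfl
    exact hne (hz.symm.trans hw)
  /- Step 3: separation systems, a finite subcover of the complement of `Nd` -/
  have hC : ∀ P ∈ Ndᶜ, ∃ k, 0 < k ∧ ∃ S : Finset (Ball → ℂ),
      (∀ f ∈ S, f ∈ holFactorForms Δ (canonicalCocycle ℂ k)) ∧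
      ∃ W : Set (orbitRel.Quotient Δ Ball × orbitRel.Quotient Δ Ball), W ∈ 𝓝 P ∧
        ∀ P' ∈ W, ∃ z w : Ball, mk z = P'.1 ∧ mk w = P'.2 ∧
          ∃ f ∈ S, ∃ g ∈ S, f z * g w ≠ f w * g z := by
    intro P hP
    have hne : P.1 ≠ P.2 := by
      intro h
      apply hP
      have : P = (P.1, P.1) := Prod.ext rfl h.symm
      rw [this]
      exact hdiag P.1
    have horb : ∀ δ : Δ, δ • P.1.out ≠ P.2.out := by
      intro δ h
      apply hne
      rw [← hmk_out P.1, ← hmk_out P.2, hmk_eq]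
      exact ⟨δ⁻¹, by rw [← h, inv_smul_smul]⟩
    obtain ⟨k, hk, f, hf, g, hg, hfg⟩ := hsep P.1.out P.2.out horb
    have hShol : ∀ h ∈ ({f, g} : Finset (Ball → ℂ)), h ∈ holomorphic ℂ := by
      intro h hh
      rcases Finset.mem_insert.1 hh with rfl | hh
      · exact (BallForms.mem_holFactorForms_iff.1 hf).2
      · rw [Finset.mem_singleton.1 hh]; exact (BallForms.mem_holFactorForms_iff.1 hg).2
    refine ⟨k, hk, {f, g}, fun h hh ↦ ?_, (fun P' : Ball × Ball ↦ (mk P'.1, mk P'.2)) ''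
      {P' : Ball × Ball | ∃ f' ∈ ({f, g} : Finset (Ball → ℂ)), ∃ g' ∈ ({f, g} : Finset (Ball → ℂ)),
        f' P'.1 * g' P'.2 ≠ f' P'.2 * g' P'.1}, ?_, ?_⟩
    · rcases Finset.mem_insert.1 hh with rfl | hh
      · exact hf
      · rw [Finset.mem_singleton.1 hh]; exact hg
    · refine ((hmk_open.prodMap hmk_open) _ (isOpen_setOf_sep hShol)).mem_nhds ?_
      refine ⟨(P.1.out, P.2.out), ⟨f, by simp, g, by simp, hfg⟩, ?_⟩
      simp only [Prod.map, hmk_out]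
    · rintro P' ⟨Q, ⟨f', hf', g', hg', hQ⟩, rfl⟩
      exact ⟨Q.1, Q.2, rfl, rfl, f', hf', g', hg', hQ⟩
  choose! kC hkC SC hSC W hWn hWsep using hC
  obtain ⟨t₂, ht₂C, ht₂⟩ := (hNdo.isClosed_compl.isCompact).elim_nhds_subcover W hWn
  /- Step 4: one common weight for `T₁` and the separation systems -/
  obtain ⟨K, hK, T, hT, hraise⟩ := exists_common_weight (Δ := Δ)
    (insert none (t₂.image Option.some))
    (fun o ↦ o.elim K₁ kC) (fun o ↦ o.elim T₁ SC)
    (by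
      intro o ho
      rcases Finset.mem_insert.1 ho with rfl | ho
      · exact hK₁
      · obtain ⟨P, hP, rfl⟩ := Finset.mem_image.1 ho
        exact hkC P (ht₂C P hP))
    (by
      intro o ho
      rcases Finset.mem_insert.1 ho with rfl | ho
      · exact hT₁
      · obtain ⟨P, hP, rfl⟩ := Finset.mem_image.1 ho
        exact hSC P (ht₂C P hP))
  have hThol : ∀ f ∈ T, f ∈ holomorphic ℂ := fun f hf ↦ (BallForms.mem_holFactorForms_iff.1 (hT f hf)).2
  -- (a) immersion everywhere
  have himmT : ∀ q : orbitRel.Quotient Δ Ball, ∃ w : Ball, mk w = q ∧ (∃ f ∈ T, f w ≠ 0) ∧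
      ∀ (u : Fin 2 → ℂ) (μ : ℂ), (∀ f ∈ T, fderiv ℂ (extend ℂ f) w.1 u = μ * f w) → u = 0 := by
    intro q
    obtain ⟨w, hwq, hw⟩ := himm₁ q
    obtain ⟨j, hj⟩ := hraise none (Finset.mem_insert_self _ _)
    exact ⟨w, hwq, imm_mono_raise hT₁hol hj hw⟩
  -- (b) separation of any two distinct points
  have hsepT : ∀ a b : orbitRel.Quotient Δ Ball, a ≠ b → ∃ z w : Ball, mk z = a ∧ mk w = b ∧
      ∃ f ∈ T, ∃ g ∈ T, f z * g w ≠ f w * g z := by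
    intro a b hab
    by_cases hP : (a, b) ∈ Nd
    · obtain ⟨z, w, hz, hw, hzw⟩ := hNdsep (a, b) hP hab
      obtain ⟨j, hj⟩ := hraise none (Finset.mem_insert_self _ _)
      exact ⟨z, w, hz, hw, sep_mono_raise hj hzw⟩
    · obtain ⟨P, hP₂, hPW⟩ := Set.mem_iUnion₂.1 (ht₂ hP)
      obtain ⟨z, w, hz, hw, hzw⟩ := hWsep P (ht₂C P hP₂) (a, b) hPW
      obtain ⟨j, hj⟩ := hraise (some P)
        (Finset.mem_insert_of_mem (Finset.mem_image_of_mem _ hP₂))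
      exact ⟨z, w, hz, hw, sep_mono_raise hj hzw⟩
  -- non-vanishing of `T` at every point of the ball
  have hnzT : ∀ z : Ball, ∃ f ∈ T, f z ≠ 0 := by
    intro z
    obtain ⟨w, hw, hnz, -⟩ := himmT (mk z)
    obtain ⟨δ, rfl⟩ := (hmk_eq w z).1 hw
    exact (exists_ne_zero_smul_iff hT δ z).1 hnz
  /- Step 5: the map -/
  have hTne : T.Nonempty := by
    obtain ⟨f, hf, -⟩ := hnzT BallModel.x₀
    exact ⟨f, hf⟩
  obtain ⟨N, hN⟩ : ∃ N : ℕ, T.card = N + 1 := Nat.exists_eq_succ_of_ne_zero (Finset.card_ne_zero.2 hTne)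
  set e : Fin (N + 1) ≃ T := (finCongr hN.symm).trans T.equivFin.symm with he
  set g : Fin (N + 1) → Ball → ℂ := fun i ↦ (e i).1 with hg_def
  have hgT : ∀ i, g i ∈ T := fun i ↦ (e i).2
  have hge : ∀ f (hf : f ∈ T), g (e.symm ⟨f, hf⟩) = f := fun f hf ↦ by
    simp only [hg_def, Equiv.apply_symm_apply]
  have hghol : ∀ i, g i ∈ holomorphic ℂ := fun i ↦ hThol _ (hgT i)
  have hnz : ∀ z : Ball, (fun i ↦ g i z) ≠ 0 := by
    intro z h0
    obtain ⟨f, hf, hfz⟩ := hnzT z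
    exact hfz (by simpa [hge f hf] using congrFun h0 (e.symm ⟨f, hf⟩))
  -- invariance along orbits
  have hinv : ∀ (δ : Δ) (z : Ball), Projectivization.mk ℂ (fun i ↦ g i (δ • z)) (hnz (δ • z)) =
      Projectivization.mk ℂ (fun i ↦ g i z) (hnz z) := fun δ z ↦
    (projectivizationMk_eq_iff hnz (δ • z) z).2
      ⟨(canonicalFactor (δ : U21) z ^ K)⁻¹, fun i ↦ apply_smul_eq (hT _ (hgT i)) δ z⟩
  set Ft : Ball → ℙ ℂ (Fin (N + 1) → ℂ) := fun z ↦ Projectivization.mk ℂ (fun i ↦ g i z) (hnz z)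
    with hFt
  set F : orbitRel.Quotient Δ Ball → ℙ ℂ (Fin (N + 1) → ℂ) := Quotient.lift Ft (by
    intro a b hab
    obtain ⟨δ, rfl⟩ := MulAction.orbitRel_apply.1 hab
    exact hinv δ b) with hF_def
  have hF : ∀ z, F (mk z) = Ft z := fun z ↦ rfl
  have hFsmooth : ContMDiff 𝓘(ℂ, Fin 2 → ℂ) 𝓘(ℂ, Fin N → ℂ) ω F :=
    contMDiff_of_comp_mk Δ hF (contMDiff_projectivizationMk hghol hnz)
  refine ⟨N, F, hFsmooth, fun a b hab ↦ ?_, fun x ↦ ?_⟩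
  · -- injectivity
    by_contra hne
    obtain ⟨z, w, rfl, rfl, f, hf, f', hf', hminor⟩ := hsepT a b hne
    rw [hF, hF] at hab
    obtain ⟨c, hc⟩ := (projectivizationMk_eq_iff hnz z w).1 hab
    apply hminor
    have h1 := hc (e.symm ⟨f, hf⟩)
    have h2 := hc (e.symm ⟨f', hf'⟩)
    rw [hge] at h1 h2
    rw [h1, h2]
    ring
  · -- immersion
    obtain ⟨w, rfl, -, himmw⟩ := himmT x
    refine injective_mfderiv_of_comp_mk Δ hF w ((hFsmooth _).mdifferentiableAt (by simp)) ?_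
    exact injective_mfderiv_projectivizationMk hghol hnz w fun u μ hu ↦
      himmw u μ fun f hf ↦ by simpa [hge f hf] using hu (e.symm ⟨f, hf⟩)

/-- **Shafarevich's theorem on the ball — assembly, cocompact lattices**: the same for `Δ` cocompact in `U(2,1)`
(`CompactSpace (U21 ⧸ Δ)`; the quotient `Δ\𝔹²` is then compact,
`BallModel.compactSpace_quotient_of_compactSpace_quotientGroup`). [cite: Shafarevich1994, Ch. IX §3.2, Theorem] -/
theorem exists_projective_embedding_of_separation_of_cocompact [CompactSpace (U21 ⧸ Δ)]
    (hsep : ∀ z w : Ball, (∀ δ : Δ, δ • z ≠ w) → ∃ k, 0 < k ∧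
      ∃ f ∈ holFactorForms Δ (canonicalCocycle ℂ k), ∃ g ∈ holFactorForms Δ (canonicalCocycle ℂ k),
        f z * g w ≠ f w * g z)
    (himm : ∀ z : Ball, ∃ k, 0 < k ∧ ∃ S : Finset (Ball → ℂ),
      (∀ f ∈ S, f ∈ holFactorForms Δ (canonicalCocycle ℂ k)) ∧ (∃ f ∈ S, f z ≠ 0) ∧
        ∀ (u : Fin 2 → ℂ) (μ : ℂ), (∀ f ∈ S, fderiv ℂ (extend ℂ f) z.1 u = μ * f z) → u = 0) :
    ∃ (N : ℕ) (F : orbitRel.Quotient Δ Ball → ℙ ℂ (Fin (N + 1) → ℂ)),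
      ContMDiff 𝓘(ℂ, Fin 2 → ℂ) 𝓘(ℂ, Fin N → ℂ) ω F ∧ Function.Injective F ∧
        ∀ x, Function.Injective (mfderiv 𝓘(ℂ, Fin 2 → ℂ) 𝓘(ℂ, Fin N → ℂ) F x) := by
  haveI : CompactSpace (orbitRel.Quotient Δ Ball) :=
    BallModel.compactSpace_quotient_of_compactSpace_quotientGroup Δ
  exact exists_projective_embedding_of_separation Δ hsep himm

end Embedding


/-! ### §10 The tangent-separation hypothesis in determinant form -/

section DetForm

open scoped Classical

/-- **Determinant form of the immersion condition.** If for three functions `f₀, f₁, f₂` the `3 × 3`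
matrix of values and first derivatives at `z` (rows `(fᵢ(z), ∂₀fᵢ(z), ∂₁fᵢ(z))`) is invertible, then the
system `{f₀, f₁, f₂}` does not vanish at `z` and its projectivised differential at `z` is injective (kernel
form): a relation `dfᵢ(z)u = μ fᵢ(z)` is the vector `(-μ, u₀, u₁)` in the kernel of the matrix.
[cite: Shafarevich1994, Ch. IX §3.2, Lemma (separation of tangent vectors)] -/
theorem imm_of_det_ne_zero {f : Fin 3 → Ball → ℂ} {z : Ball}
    (h : (Matrix.of fun i : Fin 3 ↦ ![f i z, fderiv ℂ (extend ℂ (f i)) z.1 (Pi.single 0 1),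
        fderiv ℂ (extend ℂ (f i)) z.1 (Pi.single 1 1)]).det ≠ 0) :
    (∃ g ∈ (Finset.univ.image f), g z ≠ 0) ∧ ∀ (u : Fin 2 → ℂ) (μ : ℂ),
      (∀ g ∈ (Finset.univ.image f), fderiv ℂ (extend ℂ g) z.1 u = μ * g z) → u = 0 := by
  constructor
  · by_contra hall
    push Not at hall
    apply h
    refine Matrix.det_eq_zero_of_column_eq_zero 0 fun i ↦ ?_
    simpa using hall (f i) (Finset.mem_image_of_mem f (Finset.mem_univ i))
  · intro u μ hu
    have hdec : ∀ i, fderiv ℂ (extend ℂ (f i)) z.1 u =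
        u 0 * fderiv ℂ (extend ℂ (f i)) z.1 (Pi.single 0 1) +
          u 1 * fderiv ℂ (extend ℂ (f i)) z.1 (Pi.single 1 1) := by
      intro i
      have hu' : u = u 0 • (Pi.single 0 1 : Fin 2 → ℂ) + u 1 • (Pi.single 1 1 : Fin 2 → ℂ) := by
        ext i; fin_cases i <;> simp
      conv_lhs => rw [hu']
      rw [map_add, map_smul, map_smul, smul_eq_mul, smul_eq_mul]
    have hv : (Matrix.of fun i : Fin 3 ↦ ![f i z, fderiv ℂ (extend ℂ (f i)) z.1 (Pi.single 0 1),
        fderiv ℂ (extend ℂ (f i)) z.1 (Pi.single 1 1)]).mulVec ![-μ, u 0, u 1] = 0 := by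
      ext i
      have := hu (f i) (Finset.mem_image_of_mem f (Finset.mem_univ i))
      rw [hdec] at this
      simp only [Matrix.mulVec, dotProduct, Fin.sum_univ_three, Matrix.of_apply,
        Matrix.cons_val_zero, Matrix.cons_val_one, Matrix.cons_val, Pi.zero_apply]
      linear_combination this
    have h0 := Matrix.eq_zero_of_mulVec_eq_zero h hv
    ext i
    fin_cases i
    · simpa using congrFun h0 1
    · simpa using congrFun h0 2

variable (Δ) [ProperlyDiscontinuousSMul Δ Ball] [IsCancelSMul Δ Ball]

/-- **Shafarevich's theorem on the ball — assembly, determinant form of the tangent hypothesis**: as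
`exists_projective_embedding_of_separation`, with tangent separation given at each point by three forms
`f₀, f₁, f₂` of one positive weight whose matrix of values and first derivatives is invertible.
[cite: Shafarevich1994, Ch. IX §3.2, Theorem] -/
theorem exists_projective_embedding_of_det [CompactSpace (orbitRel.Quotient Δ Ball)]
    (hsep : ∀ z w : Ball, (∀ δ : Δ, δ • z ≠ w) → ∃ k, 0 < k ∧
      ∃ f ∈ holFactorForms Δ (canonicalCocycle ℂ k), ∃ g ∈ holFactorForms Δ (canonicalCocycle ℂ k),
        f z * g w ≠ f w * g z)
    (himm : ∀ z : Ball, ∃ k, 0 < k ∧ ∃ f : Fin 3 → Ball → ℂ,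
      (∀ i, f i ∈ holFactorForms Δ (canonicalCocycle ℂ k)) ∧
        (Matrix.of fun i : Fin 3 ↦ ![f i z, fderiv ℂ (extend ℂ (f i)) z.1 (Pi.single 0 1),
          fderiv ℂ (extend ℂ (f i)) z.1 (Pi.single 1 1)]).det ≠ 0) :
    ∃ (N : ℕ) (F : orbitRel.Quotient Δ Ball → ℙ ℂ (Fin (N + 1) → ℂ)),
      ContMDiff 𝓘(ℂ, Fin 2 → ℂ) 𝓘(ℂ, Fin N → ℂ) ω F ∧ Function.Injective F ∧
        ∀ x, Function.Injective (mfderiv 𝓘(ℂ, Fin 2 → ℂ) 𝓘(ℂ, Fin N → ℂ) F x) := by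
  refine exists_projective_embedding_of_separation Δ hsep fun z ↦ ?_
  obtain ⟨k, hk, f, hf, hdet⟩ := himm z
  refine ⟨k, hk, Finset.univ.image f, fun g hg ↦ ?_, imm_of_det_ne_zero hdet⟩
  obtain ⟨i, -, rfl⟩ := Finset.mem_image.1 hg
  exact hf i


/-- **Shafarevich's theorem on the ball — assembly, tangent hypothesis with derivative witnesses**: as
`exists_projective_embedding_of_det`, the first derivatives being given by `HasFDerivAt` witnesses `L i`
(the literal shape of `BallPoincare.exists_poincareSeries_immersion_subgroup`).
[cite: Shafarevich1994, Ch. IX §3.2, Theorem] -/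
theorem exists_projective_embedding_of_hasFDerivAt [CompactSpace (orbitRel.Quotient Δ Ball)]
    (hsep : ∀ z w : Ball, (∀ δ : Δ, δ • z ≠ w) → ∃ k, 0 < k ∧
      ∃ f ∈ holFactorForms Δ (canonicalCocycle ℂ k), ∃ g ∈ holFactorForms Δ (canonicalCocycle ℂ k),
        f z * g w ≠ f w * g z)
    (himm : ∀ z : Ball, ∃ k, 0 < k ∧ ∃ f : Fin 3 → Ball → ℂ,
      (∀ i, f i ∈ holFactorForms Δ (canonicalCocycle ℂ k)) ∧
        ∃ L : Fin 3 → ((Fin 2 → ℂ) →L[ℂ] ℂ), (∀ i, HasFDerivAt (extend ℂ (f i)) (L i) z.1) ∧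
          (Matrix.of fun i : Fin 3 ↦ ![f i z, L i (Pi.single 0 1), L i (Pi.single 1 1)]).det ≠ 0) :
    ∃ (N : ℕ) (F : orbitRel.Quotient Δ Ball → ℙ ℂ (Fin (N + 1) → ℂ)),
      ContMDiff 𝓘(ℂ, Fin 2 → ℂ) 𝓘(ℂ, Fin N → ℂ) ω F ∧ Function.Injective F ∧
        ∀ x, Function.Injective (mfderiv 𝓘(ℂ, Fin 2 → ℂ) 𝓘(ℂ, Fin N → ℂ) F x) := by
  refine exists_projective_embedding_of_det Δ hsep fun z ↦ ?_
  obtain ⟨k, hk, f, hf, L, hL, hdet⟩ := himm z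
  refine ⟨k, hk, f, hf, ?_⟩
  have heq : (Matrix.of fun i : Fin 3 ↦ ![f i z, fderiv ℂ (extend ℂ (f i)) z.1 (Pi.single 0 1),
      fderiv ℂ (extend ℂ (f i)) z.1 (Pi.single 1 1)]) =
      Matrix.of fun i : Fin 3 ↦ ![f i z, L i (Pi.single 0 1), L i (Pi.single 1 1)] := by
    ext i j
    simp only [Matrix.of_apply, (hL i).fderiv]
  rw [heq]
  exact hdet

end DetForm

end BallProjective

end Literature.AlgebraicGeometry.ShimuraVarieties

end
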